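import Summits.Ventures.YMGap.Thresholds.PressureZeroCoupling
import Summits.Ventures.YMGap.YM3IR.AxialPairCount
import HarnessLib

/-!
# Two distinct plaquettes share at most one link; resampling a private link under the infinite Haar product
# `dg_∞` (THE DLR state at `β = 0`): every plaquette moment with a plaquette of multiplicity one vanishes
# (row type C-PRESS, endpoint `β = 0`, part 11a)

Cell `pub-ymgap`, seat ds-1 (gen 11). HONEST FRAMING: exact strong-coupling LATTICE statements AT `β = 0` for `SU(N)`
Wilson lattice gauge theory on `ℤ^d` (any `d`, any `N ≥ 2`): moments of the plaquette variables `W_p = (1/N) Re tr U_p`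
under the product Haar measure `zdHaar d G`; nothing about `β > 0`, nothing about the continuum or the Clay problem.
Kernel theorems only, 0 compute, no definitions.

* **A. Private links (combinatorics of `ℤ^d` plaquettes).** Two DISTINCT plaquettes share AT MOST ONE link
  (`eq_of_mem_plaquetteEdges_of_ne`: any two of its four links determine a plaquette; `card_inter_plaquetteEdges_le_one`);
  hence a plaquette `s` outside a set `T` of at most three plaquettes has a link lying in no member of `T`
  (`exists_mem_plaquetteEdges_forall_not_mem`: pigeonhole on the four links of `s`, `YM3IR.card_plaquetteEdges_eq`).
* **B. Resampling a private link.** If `e` is a link of `s` and the continuous function `Ψ` does not depend on `U_e`, then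
  under `dg_∞` the plaquette matrix `U_s` is Haar distributed independently of `Ψ`: `∫ Φ(U_s) Ψ dg_∞ = (∫ Φ dHaar) · ∫ Ψ dg_∞`
  (`integral_comp_plaquette_mul_eq`: Fubini over the link `e`, `integral_infinitePi_eq_integral_update`, and one-link Haar
  invariance, `integral_update_plaquette`). Consequences for `G ≅ SU(N)`, `N ≥ 2`: every plaquette moment of order `3` or `4`
  in which some plaquette occurs exactly once vanishes (`integral_mul₂_eq_zero_of_ne`, `integral_mul₃_eq_zero_of_ne`);
  `∫ W_p² W_q² dg_∞ = (V₀/N²)²` for `p ≠ q` (`integral_sq_mul_sq_zdHaar`); `∫ W_p W_q dg_∞ = δ_{pq} V₀/N²` (`integral_mul_zdHaar`);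
  `∫ W_p⁴ dg_∞`, `∫ W_p³ dg_∞` are the one-matrix Haar moments (`integral_pow_four_zdHaar`, `integral_pow_three_zdHaar`).
Part 11b (`ZeroCouplingMoments`) evaluates everything for `SU(2)` with part 10 (`HaarFourthMoment`): all third moments vanish and
the joint fourth cumulant is `−δ_{p=q=r=s}/16` — the number behind the fourth Balian–Drouffe–Itzykson coefficient `f⁗(0) = −6`.
References: Balian–Drouffe–Itzykson, Phys. Rev. D 11 (1975) 2104 §III; Osterwalder–Seiler, Ann. Phys. 110 (1978) 440 §3.
Everything here is proved. [folklore]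
-/

noncomputable section

open MeasureTheory Finset
open Literature.MathematicalPhysics.QuantumLattice (ZdPlaquette plaquetteEdges fundamentalRep plaquetteObs)
open Literature.MathematicalPhysics.QuantumFieldTheory hiding ZdEdge
open Literature.Probability.LatticeModels (Site)

namespace Summit.Ventures.YMGap.ZeroCouplingMoments

/-! ## A. Private links -/

section Combinatorics

variable {d : ℕ}

/-- `x + e_m + e_n ≠ x` in `ℤ^d`. [folklore] -/
theorem add_single_add_single_ne (x : Site d) (m n : Fin d) : x + Pi.single m 1 + Pi.single n 1 ≠ x := by
  intro h
  rw [add_assoc] at h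
  exact single_add_single_ne_zero m n (add_eq_left.mp h)

/-- Offsets: if `x − y ∈ {0, ± e_m} ∩ {0, ± e_n}` with `m ≠ n` then `x = y`. [folklore] -/
theorem eq_of_offsets {x y : Site d} {m n : Fin d} (hmn : m ≠ n)
    (h1 : x = y ∨ x = y + Pi.single m 1 ∨ y = x + Pi.single m 1)
    (h2 : x = y ∨ x = y + Pi.single n 1 ∨ y = x + Pi.single n 1) : x = y := by
  rcases h1 with h1 | h1 | h1
  · exact h1
  · rcases h2 with h2 | h2 | h2
    · exact h2
    · exact absurd (single_index_injective (add_left_cancel (h1.symm.trans h2))) hmn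
    · exfalso; rw [h1] at h2; exact add_single_add_single_ne y m n h2.symm
  · rcases h2 with h2 | h2 | h2
    · exact h2
    · exfalso; rw [h1] at h2; exact add_single_add_single_ne x m n h2.symm
    · exact absurd (single_index_injective (add_left_cancel (h1.symm.trans h2))) hmn

/-- The position of ONE edge relative to two plaquettes sharing it and its direction structure: from
`z ∈ {x, x + s}` and `z ∈ {y, y + s}` conclude `x − y ∈ {0, ± s}`. [folklore] -/
theorem offsets_of_mem {z x y s : Site d} (hp : z = x ∨ z = x + s) (hq : z = y ∨ z = y + s) :
    x = y ∨ x = y + s ∨ y = x + s := by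
  rcases hp with rfl | rfl <;> rcases hq with h | h
  · exact Or.inl h
  · exact Or.inr (Or.inl h)
  · exact Or.inr (Or.inr h.symm)
  · exact Or.inl (add_right_cancel h)

/-- Two PARALLEL edges `{z₁, z₂} = {x, x + e_m} = {y, y + e_n}` (as ordered pairs of distinct sites) force `x = y` and
`m = n`. [folklore] -/
theorem eq_of_parallel {z₁ z₂ x y : Site d} {m n : Fin d}
    (hp : z₁ = x ∧ z₂ = x + Pi.single m 1 ∨ z₁ = x + Pi.single m 1 ∧ z₂ = x)
    (hq : z₁ = y ∧ z₂ = y + Pi.single n 1 ∨ z₁ = y + Pi.single n 1 ∧ z₂ = y) : x = y ∧ m = n := by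
  rcases hp with ⟨rfl, rfl⟩ | ⟨rfl, rfl⟩ <;> rcases hq with ⟨h1, h2⟩ | ⟨h1, h2⟩
  · subst h1; exact ⟨rfl, single_index_injective (add_left_cancel h2)⟩
  · exfalso; rw [h1] at h2; exact add_single_add_single_ne _ n m h2
  · exfalso; rw [h2] at h1; exact add_single_add_single_ne _ n m h1
  · subst h2; exact ⟨rfl, single_index_injective (add_left_cancel h1)⟩

/-- ★ **Two distinct plaquettes of `ℤ^d` share at most one link**: if two DISTINCT edges `e₁ ≠ e₂` both lie in the
plaquettes `p` and `q`, then `p = q` (any two of its four links determine a plaquette). [folklore] -/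
theorem eq_of_mem_plaquetteEdges_of_ne {p q : ZdPlaquette d}
    {e₁ e₂ : Literature.MathematicalPhysics.QuantumLattice.ZdEdge d} (hne : e₁ ≠ e₂)
    (h1p : e₁ ∈ plaquetteEdges p) (h2p : e₂ ∈ plaquetteEdges p)
    (h1q : e₁ ∈ plaquetteEdges q) (h2q : e₂ ∈ plaquetteEdges q) : p = q := by
  obtain ⟨x, ⟨⟨i, j⟩, hij⟩⟩ := p
  obtain ⟨y, ⟨⟨k, l⟩, hkl⟩⟩ := q
  obtain ⟨z₁, m₁⟩ := e₁
  obtain ⟨z₂, m₂⟩ := e₂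
  have hij' : (i : ℕ) < j := hij
  have hkl' : (k : ℕ) < l := hkl
  rw [mk_mem_plaquetteEdges_iff] at h1p h2p h1q h2q
  simp only at h1p h2p h1q h2q
  suffices h : x = y ∧ i = k ∧ j = l by
    obtain ⟨rfl, rfl, rfl⟩ := h; rfl
  have hz : m₁ = m₂ → z₁ ≠ z₂ := by rintro rfl h; exact hne (by rw [h])
  rcases h1p with ⟨rfl, hz1p⟩ | ⟨rfl, hz1p⟩ <;> rcases h2p with ⟨h2, hz2p⟩ | ⟨h2, hz2p⟩
  · -- both edges in direction `i` of `p`: `{z₁, z₂} = {x, x + e_j}`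
    have hz12 := hz h2
    subst h2
    have hpar : z₁ = x ∧ z₂ = x + Pi.single j 1 ∨ z₁ = x + Pi.single j 1 ∧ z₂ = x := by
      rcases hz1p with rfl | rfl <;> rcases hz2p with rfl | rfl
      · exact absurd rfl hz12
      · exact Or.inl ⟨rfl, rfl⟩
      · exact Or.inr ⟨rfl, rfl⟩
      · exact absurd rfl hz12
    rcases h1q with ⟨h1, hz1q⟩ | ⟨h1, hz1q⟩ <;> rcases h2q with ⟨h2', hz2q⟩ | ⟨h2', hz2q⟩
    · subst h1
      have hqar : z₁ = y ∧ z₂ = y + Pi.single l 1 ∨ z₁ = y + Pi.single l 1 ∧ z₂ = y := by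
        rcases hz1q with h | h <;> rcases hz2q with h' | h'
        · exact absurd (h.trans h'.symm) hz12
        · exact Or.inl ⟨h, h'⟩
        · exact Or.inr ⟨h, h'⟩
        · exact absurd (h.trans h'.symm) hz12
      obtain ⟨hxy, hjl⟩ := eq_of_parallel hpar hqar
      exact ⟨hxy, rfl, hjl⟩
    · exfalso; subst h1; subst h2'; omega
    · exfalso; subst h1; subst h2'; omega
    · subst h1
      have hqar : z₁ = y ∧ z₂ = y + Pi.single k 1 ∨ z₁ = y + Pi.single k 1 ∧ z₂ = y := by
        rcases hz1q with h | h <;> rcases hz2q with h' | h'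
        · exact absurd (h.trans h'.symm) hz12
        · exact Or.inr ⟨h, h'⟩
        · exact Or.inl ⟨h, h'⟩
        · exact absurd (h.trans h'.symm) hz12
      obtain ⟨-, hjk⟩ := eq_of_parallel hpar hqar
      exfalso; subst hjk; omega
  · -- `e₁` in direction `i`, `e₂` in direction `j`
    subst h2
    rcases h1q with ⟨h1, hz1q⟩ | ⟨h1, hz1q⟩ <;> rcases h2q with ⟨h2', hz2q⟩ | ⟨h2', hz2q⟩
    · exfalso; subst h1; subst h2'; omega
    · subst h1; subst h2'
      have o1 := offsets_of_mem hz1p hz1q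
      have o2 := offsets_of_mem (hz2p.elim Or.inr Or.inl) (hz2q.elim Or.inr Or.inl)
      exact ⟨eq_of_offsets (fun h => by subst h; omega) o1 o2, rfl, rfl⟩
    · exfalso; subst h1; subst h2'; omega
    · exfalso; subst h1; subst h2'; omega
  · -- `e₁` in direction `j`, `e₂` in direction `i`
    subst h2
    rcases h1q with ⟨h1, hz1q⟩ | ⟨h1, hz1q⟩ <;> rcases h2q with ⟨h2', hz2q⟩ | ⟨h2', hz2q⟩
    · exfalso; subst h1; subst h2'; omega
    · exfalso; subst h1; subst h2'; omega
    · subst h1; subst h2'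
      have o1 := offsets_of_mem (hz1p.elim Or.inr Or.inl) (hz1q.elim Or.inr Or.inl)
      have o2 := offsets_of_mem hz2p hz2q
      exact ⟨eq_of_offsets (fun h => by subst h; omega) o1 o2, rfl, rfl⟩
    · exfalso; subst h1; subst h2'; omega
  · -- both edges in direction `j` of `p`: `{z₁, z₂} = {x + e_i, x}`
    have hz12 := hz h2
    subst h2
    have hpar : z₁ = x ∧ z₂ = x + Pi.single i 1 ∨ z₁ = x + Pi.single i 1 ∧ z₂ = x := by
      rcases hz1p with rfl | rfl <;> rcases hz2p with rfl | rfl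
      · exact absurd rfl hz12
      · exact Or.inr ⟨rfl, rfl⟩
      · exact Or.inl ⟨rfl, rfl⟩
      · exact absurd rfl hz12
    rcases h1q with ⟨h1, hz1q⟩ | ⟨h1, hz1q⟩ <;> rcases h2q with ⟨h2', hz2q⟩ | ⟨h2', hz2q⟩
    · subst h1
      have hqar : z₁ = y ∧ z₂ = y + Pi.single l 1 ∨ z₁ = y + Pi.single l 1 ∧ z₂ = y := by
        rcases hz1q with h | h <;> rcases hz2q with h' | h'
        · exact absurd (h.trans h'.symm) hz12
        · exact Or.inl ⟨h, h'⟩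
        · exact Or.inr ⟨h, h'⟩
        · exact absurd (h.trans h'.symm) hz12
      obtain ⟨-, hil⟩ := eq_of_parallel hpar hqar
      exfalso; subst hil; omega
    · exfalso; subst h1; subst h2'; omega
    · exfalso; subst h1; subst h2'; omega
    · subst h1
      have hqar : z₁ = y ∧ z₂ = y + Pi.single k 1 ∨ z₁ = y + Pi.single k 1 ∧ z₂ = y := by
        rcases hz1q with h | h <;> rcases hz2q with h' | h'
        · exact absurd (h.trans h'.symm) hz12
        · exact Or.inr ⟨h, h'⟩
        · exact Or.inl ⟨h, h'⟩
        · exact absurd (h.trans h'.symm) hz12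
      obtain ⟨hxy, hik⟩ := eq_of_parallel hpar hqar
      exact ⟨hxy, hik, rfl⟩

/-- Two distinct plaquettes share at most one link (cardinality form). [folklore] -/
theorem card_inter_plaquetteEdges_le_one {p q : ZdPlaquette d} (hpq : p ≠ q) :
    (plaquetteEdges p ∩ plaquetteEdges q).card ≤ 1 := by
  classical
  rw [Finset.card_le_one]
  intro e₁ h1 e₂ h2
  by_contra hne
  rw [Finset.mem_inter] at h1 h2
  exact hpq (eq_of_mem_plaquetteEdges_of_ne hne h1.1 h2.1 h1.2 h2.2)

/-- ★ **A private link**: a plaquette `s` outside a set `T` of at most three plaquettes has a link lying in no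
member of `T` (each member covers at most one of the four links of `s`). [folklore] -/
theorem exists_mem_plaquetteEdges_forall_not_mem (s : ZdPlaquette d) {T : Finset (ZdPlaquette d)} (hs : s ∉ T)
    (hT : T.card ≤ 3) : ∃ e ∈ plaquetteEdges s, ∀ t ∈ T, e ∉ plaquetteEdges t := by
  classical
  by_contra h
  push Not at h
  -- every link of `s` lies in some member of `T`; two of the four links lie in the same member
  choose f hf using h
  let F : Literature.MathematicalPhysics.QuantumLattice.ZdEdge d → ZdPlaquette d := fun e =>
    if he : e ∈ plaquetteEdges s then f e he else s
  have hFe : ∀ e (he : e ∈ plaquetteEdges s), F e = f e he := fun e he => dif_pos he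
  have hmaps : ∀ e ∈ plaquetteEdges s, F e ∈ T := fun e he => by
    rw [hFe e he]; exact (hf e he).1
  have hcard : T.card < (plaquetteEdges s).card := by rw [YM3IR.card_plaquetteEdges_eq]; omega
  obtain ⟨e₁, h1, e₂, h2, hne, hF⟩ := Finset.exists_ne_map_eq_of_card_lt_of_maps_to hcard hmaps
  have hF1 : e₁ ∈ plaquetteEdges (F e₁) := by rw [hFe e₁ h1]; exact (hf e₁ h1).2
  have hF2 : e₂ ∈ plaquetteEdges (F e₁) := by rw [hF, hFe e₂ h2]; exact (hf e₂ h2).2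
  exact hs ((eq_of_mem_plaquetteEdges_of_ne hne h1 h2 hF1 hF2) ▸ hmaps e₁ h1)

end Combinatorics

/-! ## B. Resampling a private link under the infinite Haar product -/

section Resampling

open Literature.MathematicalPhysics.QuantumFieldTheory.PlaquetteLowerBound (reTr charVariance integral_reTr_eq_zero
  integral_comp_plaquette_eq continuous_reTr)
open Literature.MathematicalPhysics.QuantumFieldTheory.AreaLaw (continuous_plaquette integrable_zdHaar_of_continuous)
open Literature.MathematicalPhysics.QuantumLattice (isCylinder_plaquetteObs)

variable {d N : ℕ} {G : Type*} [Group G] [TopologicalSpace G] [IsTopologicalGroup G] [CompactSpace G]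
  [MeasurableSpace G] [BorelSpace G] [SecondCountableTopology G]

omit [TopologicalSpace G] [IsTopologicalGroup G] [CompactSpace G] [MeasurableSpace G] [BorelSpace G]
  [SecondCountableTopology G] in
/-- `W_s = (1/N) · Re tr ρ(U_s)` (definitional unfolding of `zdPlaquetteObs`). [folklore] -/
theorem zdPlaquetteObs_eq (ρ : G →* Matrix (Fin N) (Fin N) ℂ) (s : ZdPlaquette d) (U : ZdGaugeConfig d G) :
    zdPlaquetteObs ρ s.1 s.2.1.1 s.2.1.2 U = (N : ℝ)⁻¹ * reTr ρ (U.plaquette s.1 s.2.1.1 s.2.1.2) := rfl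

omit [TopologicalSpace G] [IsTopologicalGroup G] [CompactSpace G] [MeasurableSpace G] [BorelSpace G]
  [SecondCountableTopology G] in
/-- A plaquette variable does not see a link outside the plaquette. [folklore] -/
theorem zdPlaquetteObs_update_of_not_mem (ρ : G →* Matrix (Fin N) (Fin N) ℂ) {a : ZdPlaquette d}
    {e : Literature.MathematicalPhysics.QuantumLattice.ZdEdge d} (he : e ∉ plaquetteEdges a)
    (U : ZdGaugeConfig d G) (g : G) :
    zdPlaquetteObs ρ a.1 a.2.1.1 a.2.1.2 (Function.update U e g) = zdPlaquetteObs ρ a.1 a.2.1.1 a.2.1.2 U := by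
  have h := isCylinder_plaquetteObs (G := G) ρ a
    (fun e' (he' : e' ∈ (↑(plaquetteEdges a) : Set (Literature.MathematicalPhysics.QuantumLattice.ZdEdge d))) =>
      show Function.update U e g e' = U e' by
        rw [Function.update_of_ne]; rintro rfl; exact he he')
  show (N : ℝ)⁻¹ * plaquetteObs ρ a.1 a.2.1.1 a.2.1.2 (Function.update U e g) =
    (N : ℝ)⁻¹ * plaquetteObs ρ a.1 a.2.1.1 a.2.1.2 U
  rw [h]

omit [CompactSpace G] [MeasurableSpace G] [BorelSpace G] [SecondCountableTopology G] in
/-- Plaquette variables are continuous in the configuration. [folklore] -/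
theorem continuous_zdPlaquetteObs {ρ : G →* Matrix (Fin N) (Fin N) ℂ} (hρ : Continuous ρ) (a : ZdPlaquette d) :
    Continuous (zdPlaquetteObs (d := d) ρ a.1 a.2.1.1 a.2.1.2) :=
  continuous_const.mul ((continuous_reTr ρ hρ).comp (continuous_plaquette a.1 a.2.1.1 a.2.1.2))

/-- ★ **Resampling a link of `s` that `Ψ` ignores**: if `e` is a link of the plaquette `s` and the continuous function `Ψ`
does not depend on `U_e`, then under `dg_∞` the plaquette matrix `U_s` is Haar distributed INDEPENDENTLY of `Ψ`:
`∫ Φ(U_s) Ψ dg_∞ = (∫ Φ dHaar) · ∫ Ψ dg_∞` (Fubini over the link `e`, `integral_infinitePi_eq_integral_update`, and the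
one-link Haar invariance `integral_update_plaquette`). [folklore] -/
theorem integral_comp_plaquette_mul_eq {Φ : G → ℝ} (hΦ : Continuous Φ) (s : ZdPlaquette d)
    {e : Literature.MathematicalPhysics.QuantumLattice.ZdEdge d} (he : e ∈ plaquetteEdges s)
    {Ψ : ZdGaugeConfig d G → ℝ} (hΨ : Continuous Ψ) (hΨe : ∀ (U : ZdGaugeConfig d G) (g : G), Ψ (Function.update U e g) = Ψ U) :
    ∫ U, Φ (U.plaquette s.1 s.2.1.1 s.2.1.2) * Ψ U ∂zdHaar d G =
      (∫ g, Φ g ∂haarProbability G) * ∫ U, Ψ U ∂zdHaar d G := by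
  classical
  have hint : Integrable (fun U : ZdGaugeConfig d G => Φ (U.plaquette s.1 s.2.1.1 s.2.1.2) * Ψ U) (zdHaar d G) :=
    integrable_zdHaar_of_continuous ((hΦ.comp (continuous_plaquette _ _ _)).mul hΨ)
  have he4 : e = (s.1, s.2.1.1) ∨ e = (s.1 + Pi.single s.2.1.1 1, s.2.1.2) ∨
      e = (s.1 + Pi.single s.2.1.2 1, s.2.1.1) ∨ e = (s.1, s.2.1.2) := by
    simpa [plaquetteEdges] using he
  have hupd : ∀ U : ZdGaugeConfig d G,
      ∫ g, Φ (ZdGaugeConfig.plaquette (Function.update U e g) s.1 s.2.1.1 s.2.1.2) ∂haarProbability G =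
        ∫ g, Φ g ∂haarProbability G := fun U =>
    (integral_update_plaquette (d := d) hΦ s.1 (ne_of_lt s.2.2) U he4).2
  rw [zdHaar, Literature.Probability.LatticeModels.integral_infinitePi_eq_integral_update
    (fun _ : Literature.MathematicalPhysics.QuantumLattice.ZdEdge d => haarProbability G) e hint]
  simp_rw [hΨe, integral_mul_const, hupd]
  rw [integral_const_mul]

/-- **A plaquette of multiplicity one kills a third moment**: `∫ W_s W_a W_b dg_∞ = 0` if `s ≠ a`, `s ≠ b`
(`G ≅ SU(N)`, `N ≥ 2`; resample a link of `s` outside `a` and `b`; `∫ Re tr dHaar = 0`). [folklore] -/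
theorem integral_mul₂_eq_zero_of_ne {ρ : G →* Matrix (Fin N) (Fin N) ℂ} (hρ : IsSpecialUnitaryModel ρ) (hN : 2 ≤ N)
    {s a b : ZdPlaquette d} (ha : s ≠ a) (hb : s ≠ b) :
    ∫ U, zdPlaquetteObs ρ s.1 s.2.1.1 s.2.1.2 U *
      (zdPlaquetteObs ρ a.1 a.2.1.1 a.2.1.2 U * zdPlaquetteObs ρ b.1 b.2.1.1 b.2.1.2 U) ∂zdHaar d G = 0 := by
  classical
  obtain ⟨e, hes, heT⟩ := exists_mem_plaquetteEdges_forall_not_mem s (T := {a, b})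
    (by simp [ha, hb]) ((Finset.card_insert_le _ _).trans (by simp))
  have hea : e ∉ plaquetteEdges a := heT a (by simp)
  have heb : e ∉ plaquetteEdges b := heT b (by simp)
  have hΦ : Continuous fun g : G => (N : ℝ)⁻¹ * reTr ρ g := continuous_const.mul (continuous_reTr ρ hρ.1)
  have h := integral_comp_plaquette_mul_eq (d := d) hΦ s hes
    (Ψ := fun U => zdPlaquetteObs ρ a.1 a.2.1.1 a.2.1.2 U * zdPlaquetteObs ρ b.1 b.2.1.1 b.2.1.2 U)
    ((continuous_zdPlaquetteObs hρ.1 a).mul (continuous_zdPlaquetteObs hρ.1 b))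
    (fun U g => by simp only [zdPlaquetteObs_update_of_not_mem ρ hea, zdPlaquetteObs_update_of_not_mem ρ heb])
  beta_reduce at h
  simp_rw [zdPlaquetteObs_eq ρ s]
  rw [h, integral_const_mul, integral_reTr_eq_zero ρ hρ hN, mul_zero, zero_mul]

/-- **A plaquette of multiplicity one kills a fourth moment**: `∫ W_s W_a W_b W_c dg_∞ = 0` if `s ∉ {a, b, c}`
(`G ≅ SU(N)`, `N ≥ 2`; a link of `s` outside `a`, `b`, `c` exists because distinct plaquettes share at most one link).
[folklore] -/
theorem integral_mul₃_eq_zero_of_ne {ρ : G →* Matrix (Fin N) (Fin N) ℂ} (hρ : IsSpecialUnitaryModel ρ) (hN : 2 ≤ N)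
    {s a b c : ZdPlaquette d} (ha : s ≠ a) (hb : s ≠ b) (hc : s ≠ c) :
    ∫ U, zdPlaquetteObs ρ s.1 s.2.1.1 s.2.1.2 U *
      (zdPlaquetteObs ρ a.1 a.2.1.1 a.2.1.2 U * zdPlaquetteObs ρ b.1 b.2.1.1 b.2.1.2 U *
        zdPlaquetteObs ρ c.1 c.2.1.1 c.2.1.2 U) ∂zdHaar d G = 0 := by
  classical
  obtain ⟨e, hes, heT⟩ := exists_mem_plaquetteEdges_forall_not_mem s (T := {a, b, c})
    (by simp [ha, hb, hc]) ((Finset.card_insert_le _ _).trans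
      (Nat.succ_le_succ ((Finset.card_insert_le _ _).trans (by simp))))
  have hea : e ∉ plaquetteEdges a := heT a (by simp)
  have heb : e ∉ plaquetteEdges b := heT b (by simp)
  have hec : e ∉ plaquetteEdges c := heT c (by simp)
  have hΦ : Continuous fun g : G => (N : ℝ)⁻¹ * reTr ρ g := continuous_const.mul (continuous_reTr ρ hρ.1)
  have h := integral_comp_plaquette_mul_eq (d := d) hΦ s hes
    (Ψ := fun U => zdPlaquetteObs ρ a.1 a.2.1.1 a.2.1.2 U * zdPlaquetteObs ρ b.1 b.2.1.1 b.2.1.2 U *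
      zdPlaquetteObs ρ c.1 c.2.1.1 c.2.1.2 U)
    (((continuous_zdPlaquetteObs hρ.1 a).mul (continuous_zdPlaquetteObs hρ.1 b)).mul
      (continuous_zdPlaquetteObs hρ.1 c))
    (fun U g => by
      simp only [zdPlaquetteObs_update_of_not_mem ρ hea, zdPlaquetteObs_update_of_not_mem ρ heb,
        zdPlaquetteObs_update_of_not_mem ρ hec])
  beta_reduce at h
  simp_rw [zdPlaquetteObs_eq ρ s]
  rw [h, integral_const_mul, integral_reTr_eq_zero ρ hρ hN, mul_zero, zero_mul]

/-- **Two distinct plaquettes: `∫ W_p² W_q² dg_∞ = (V₀/N²)²`** (`p ≠ q`; resample a link of `p` outside `q`). [folklore] -/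
theorem integral_sq_mul_sq_zdHaar {ρ : G →* Matrix (Fin N) (Fin N) ℂ} (hρ : IsSpecialUnitaryModel ρ)
    {p q : ZdPlaquette d} (hpq : p ≠ q) :
    ∫ U, zdPlaquetteObs ρ p.1 p.2.1.1 p.2.1.2 U ^ 2 * zdPlaquetteObs ρ q.1 q.2.1.1 q.2.1.2 U ^ 2 ∂zdHaar d G =
      (charVariance ρ / (N : ℝ) ^ 2) ^ 2 := by
  classical
  obtain ⟨e, hep, heT⟩ := exists_mem_plaquetteEdges_forall_not_mem p (T := {q}) (by simpa using hpq) (by simp)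
  have heq : e ∉ plaquetteEdges q := heT q (by simp)
  have hΦ : Continuous fun g : G => ((N : ℝ)⁻¹ * reTr ρ g) ^ 2 := (continuous_const.mul (continuous_reTr ρ hρ.1)).pow 2
  have h := integral_comp_plaquette_mul_eq (d := d) hΦ p hep
    (Ψ := fun U => zdPlaquetteObs ρ q.1 q.2.1.1 q.2.1.2 U ^ 2) ((continuous_zdPlaquetteObs hρ.1 q).pow 2)
    (fun U g => by simp only [zdPlaquetteObs_update_of_not_mem ρ heq])
  beta_reduce at h
  simp_rw [zdPlaquetteObs_eq ρ p]
  rw [h, PressureRegularity.integral_zdPlaquetteObs_sq_zdHaar hρ.1 q]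
  simp_rw [mul_pow]
  rw [integral_const_mul, charVariance]
  field_simp

/-- `∫ W_p⁴ dg_∞ = ∫ ((1/N) Re tr)⁴ dHaar` (the plaquette matrix is Haar distributed). [folklore] -/
theorem integral_pow_four_zdHaar {ρ : G →* Matrix (Fin N) (Fin N) ℂ} (hρc : Continuous ρ) (p : ZdPlaquette d) :
    ∫ U, zdPlaquetteObs ρ p.1 p.2.1.1 p.2.1.2 U ^ 4 ∂zdHaar d G =
      ∫ g, ((N : ℝ)⁻¹ * reTr ρ g) ^ 4 ∂haarProbability G := by
  have hΦ : Continuous fun g : G => ((N : ℝ)⁻¹ * reTr ρ g) ^ 4 := (continuous_const.mul (continuous_reTr ρ hρc)).pow 4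
  simp_rw [zdPlaquetteObs_eq ρ p]
  exact integral_comp_plaquette_eq (d := d) hΦ p.1 (ne_of_lt p.2.2)

/-- `∫ W_p³ dg_∞ = ∫ ((1/N) Re tr)³ dHaar`. [folklore] -/
theorem integral_pow_three_zdHaar {ρ : G →* Matrix (Fin N) (Fin N) ℂ} (hρc : Continuous ρ) (p : ZdPlaquette d) :
    ∫ U, zdPlaquetteObs ρ p.1 p.2.1.1 p.2.1.2 U ^ 3 ∂zdHaar d G =
      ∫ g, ((N : ℝ)⁻¹ * reTr ρ g) ^ 3 ∂haarProbability G := by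
  have hΦ : Continuous fun g : G => ((N : ℝ)⁻¹ * reTr ρ g) ^ 3 := (continuous_const.mul (continuous_reTr ρ hρc)).pow 3
  simp_rw [zdPlaquetteObs_eq ρ p]
  exact integral_comp_plaquette_eq (d := d) hΦ p.1 (ne_of_lt p.2.2)

/-- **Second moments**: `∫ W_p W_q dg_∞ = δ_{pq} V₀/N²` (`G ≅ SU(N)`, `N ≥ 2`; part 4's `cov_zdPlaquetteObs_zdHaar` in
moment form). [folklore] -/
theorem integral_mul_zdHaar {ρ : G →* Matrix (Fin N) (Fin N) ℂ} (hρ : IsSpecialUnitaryModel ρ) (hN : 2 ≤ N)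
    (p q : ZdPlaquette d) :
    ∫ U, zdPlaquetteObs ρ p.1 p.2.1.1 p.2.1.2 U * zdPlaquetteObs ρ q.1 q.2.1.1 q.2.1.2 U ∂zdHaar d G =
      if p = q then charVariance ρ / (N : ℝ) ^ 2 else 0 := by
  classical
  split_ifs with h
  · subst h
    simp_rw [← pow_two]
    exact PressureRegularity.integral_zdPlaquetteObs_sq_zdHaar hρ.1 p
  · exact PressureRegularity.integral_zdPlaquetteObs_mul_zdHaar hρ hN h

end Resampling

end Summit.Ventures.YMGap.ZeroCouplingMoments
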